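import Summits.AtomisticToContinuum.Crystallization.Theses.GappedShellCensus

/-!
# `TornFree` (stmt-AtomisticToContinuum-18069), negative side: tolerance family and periodic certificates

`GappedShellCensus.TornFree` (crux, rank 2): if EVERY site of `Y ⊂ ℝ³` is gapped-twelve at scale `a`
(twelve points of `Y` in `[0.98a, 1.02a]`, none closer, none in the open annulus `(1.02a, 1.26a)`),
then every bond `(y, v)` has at least four common bonded neighbours.  Disprover infrastructure
(refuter seat refuter-cdisprove-stmt-AtomisticToContinuum-18069-0, 2026-08-17; no route item is
concluded positively):
* `TornFreeTol τ γ` — the crux with `1/50 ↦ τ`, `63/50 ↦ γ`; `tornFree_iff_tornFreeTol` (`Iff.rfl`)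
  identifies the crux as the member `(1/50, 63/50)`; every tolerance / gap mutation is a member.
* PERIODIC INTEGER CERTIFICATES (`Cert`, `cert_model`): an orthorhombic box `L : ℤ³`, a motif
  `P : Fin M → ℤ³` in the box, thresholds `lo2 ≤ hi2 < gam2 ≤ (L k)²` and finitely many decidable
  integer inequalities; then EVERY site of `perSet L P = {P i + L • n}` is gapped-twelve at `(D, τ, γ)`
  when `(D(1-τ))² = lo2`, `(D(1+τ))² = hi2`, `(Dγ)² = gam2`, and the common neighbours of a bond are
  counted exactly over `Fin M × {-1,0,1}³`; `not_tornFreeTol_of_cert` is the replayer turning a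
  certificate with a bond of `≤ 3` commons into `¬ TornFreeTol τ γ`.  `TolTight.lean` instantiates it
  on strained fcc (non-vacuity, tightness of `4`).  Integer transfer as in `Negative/TwoCentre.lean`.
-/

noncomputable section

namespace Summit.AtomisticToContinuum.Crystallization.Theorems.TornFree.Negative

open Literature.Geometry.DiscreteGeometry

/-! ## The parametrised family -/

/-- `y` is gapped-twelve in `Y` at scale `a`, tolerance `τ`, gap ratio `γ`: exactly twelve other
points of `Y` within `a(1+τ)`, none closer than `a(1-τ)`, none in the open annulus `(a(1+τ), aγ)`
(the crux's inline hypothesis with `1/50 ↦ τ`, `63/50 ↦ γ`; a hypothesis-analysis predicate, not a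
literature fact). -/
def GappedTwelveAt (τ γ : ℝ) (Y : Set (EuclideanSpace ℝ (Fin 3))) (a : ℝ)
    (y : EuclideanSpace ℝ (Fin 3)) : Prop :=
  {w ∈ Y | w ≠ y ∧ dist y w ≤ a * (1 + τ)}.ncard = 12 ∧
    ∀ w ∈ Y, w ≠ y → a * (1 - τ) ≤ dist y w ∧ (dist y w ≤ a * (1 + τ) ∨ a * γ ≤ dist y w)

/-- The common bonded neighbours of `y` and `v` (bond length `≤ a(1+τ)`). -/
def commons (τ : ℝ) (Y : Set (EuclideanSpace ℝ (Fin 3))) (a : ℝ) (y v : EuclideanSpace ℝ (Fin 3)) :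
    Set (EuclideanSpace ℝ (Fin 3)) :=
  {w ∈ Y | w ≠ y ∧ w ≠ v ∧ dist y w ≤ a * (1 + τ) ∧ dist v w ≤ a * (1 + τ)}

/-- `TornFree` with the tolerance `τ` and the gap ratio `γ` as parameters (a weakened/strengthened-crux
family for hypothesis analysis, not a literature fact). -/
def TornFreeTol (τ γ : ℝ) : Prop :=
  ∀ (Y : Set (EuclideanSpace ℝ (Fin 3))) (a : ℝ), 0 < a → (∀ y ∈ Y, GappedTwelveAt τ γ Y a y) →
    ∀ y ∈ Y, ∀ v ∈ Y, v ≠ y → dist y v ≤ a * (1 + τ) → 4 ≤ (commons τ Y a y v).ncard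

/-- The crux is the member `(τ, γ) = (1/50, 63/50)` of the family (definitionally). [folklore] -/
theorem tornFree_iff_tornFreeTol :
    Theses.GappedShellCensus.TornFree ↔ TornFreeTol (1 / 50) (63 / 50) := Iff.rfl

/-! ## Periodic integer configurations -/

/-- The periodic image of motif point `i` translated by the box vector `L • n`. -/
def ppt (L : Fin 3 → ℤ) {M : ℕ} (P : Fin M → Fin 3 → ℤ) (i : Fin M) (n : Fin 3 → ℤ) : Fin 3 → ℤ :=
  fun k => P i k + L k * n k

/-- The point of `ℝ³` indexed by `q = (motif index, box offset)`. -/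
def pp (L : Fin 3 → ℤ) {M : ℕ} (P : Fin M → Fin 3 → ℤ) (q : Fin M × (Fin 3 → ℤ)) :
    EuclideanSpace ℝ (Fin 3) :=
  intVec (ppt L P q.1 q.2)

/-- The periodic point set generated by the motif `P` and the orthorhombic box `L`. -/
def perSet (L : Fin 3 → ℤ) {M : ℕ} (P : Fin M → Fin 3 → ℤ) : Set (EuclideanSpace ℝ (Fin 3)) :=
  Set.range (pp L P)

/-- Decoding of `Fin 27` into the offsets `{-1,0,1}³` (`13 ↦ 0`). -/
def off27 (e : Fin 27) : Fin 3 → ℤ :=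
  ![((e.val / 9 : ℕ) : ℤ) - 1, ((e.val / 3 % 3 : ℕ) : ℤ) - 1, ((e.val % 3 : ℕ) : ℤ) - 1]

/-- Squared distance from motif point `i` (offset `0`) to the image of `j` at offset `d`. -/
def sqd (L : Fin 3 → ℤ) {M : ℕ} (P : Fin M → Fin 3 → ℤ) (i j : Fin M) (d : Fin 3 → ℤ) : ℤ :=
  sqNormInt (ppt L P j d - ppt L P i 0)

/-- The offset decoded from `13` is `0`. -/
theorem off27_thirteen : off27 13 = 0 := by decide

/-- `off27` is injective. -/
theorem off27_injective : Function.Injective off27 := by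
  unfold Function.Injective; decide

/-- Only `13` decodes to the zero offset. -/
theorem off27_eq_zero_iff (e : Fin 27) : off27 e = 0 ↔ e = 13 := by
  revert e; decide

/-- An offset in `{-1,0,1}³` is decoded by some `e : Fin 27`. -/
theorem exists_off27_of_box (d : Fin 3 → ℤ) (h : ∀ k, -1 ≤ d k ∧ d k ≤ 1) :
    ∃ e : Fin 27, off27 e = d := by
  have key : ∀ a : ℤ, -1 ≤ a ∧ a ≤ 1 → a = -1 ∨ a = 0 ∨ a = 1 := by intro a ha; omega
  rcases key _ (h 0) with e0 | e0 | e0 <;> rcases key _ (h 1) with e1 | e1 | e1 <;>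
    rcases key _ (h 2) with e2 | e2 | e2 <;>
    · refine ⟨⟨((d 0 + 1) * 9 + (d 1 + 1) * 3 + (d 2 + 1)).toNat, by omega⟩, ?_⟩
      funext k; fin_cases k <;> simp [off27, e0, e1, e2]

/-- Unfolding of `pp` on a pair. -/
theorem pp_mk (L : Fin 3 → ℤ) {M : ℕ} (P : Fin M → Fin 3 → ℤ) (i : Fin M) (n : Fin 3 → ℤ) :
    pp L P (i, n) = intVec (ppt L P i n) := rfl

/-- Differences of periodic images only depend on the offset difference. -/
theorem ppt_sub_ppt (L : Fin 3 → ℤ) {M : ℕ} (P : Fin M → Fin 3 → ℤ) (i j : Fin M)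
    (n n' : Fin 3 → ℤ) : ppt L P j n' - ppt L P i n = ppt L P j (n' - n) - ppt L P i 0 := by
  funext k; simp [ppt]; ring

/-- `dist` of two integer points is the square root of the integer squared norm of the difference. -/
theorem dist_intVec (u v : Fin 3 → ℤ) :
    dist (intVec u) (intVec v) = Real.sqrt (sqNormInt (u - v) : ℝ) := by
  rw [dist_eq_norm, intVec_sub, norm_intVec]

/-- A single coordinate bounds the squared norm from below. -/
theorem sq_le_sqNormInt (v : Fin 3 → ℤ) (k : Fin 3) : v k ^ 2 ≤ sqNormInt v := by
  unfold sqNormInt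
  fin_cases k <;> simp <;> nlinarith [sq_nonneg (v 0), sq_nonneg (v 1), sq_nonneg (v 2)]

/-- `dist ≤ c` between integer points as an integer inequality on the squared norm (`c² = c2`). -/
theorem dist_intVec_le_iff {u v : Fin 3 → ℤ} {c : ℝ} {c2 : ℤ} (hc : 0 ≤ c) (hc2 : c ^ 2 = c2) :
    dist (intVec u) (intVec v) ≤ c ↔ sqNormInt (u - v) ≤ c2 := by
  rw [dist_intVec, Real.sqrt_le_left hc, hc2, Int.cast_le]

/-- `c ≤ dist` between integer points as an integer inequality on the squared norm (`c² = c2`). -/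
theorem le_dist_intVec_iff {u v : Fin 3 → ℤ} {c : ℝ} {c2 : ℤ} (hc : 0 ≤ c) (hc2 : c ^ 2 = c2) :
    c ≤ dist (intVec u) (intVec v) ↔ c2 ≤ sqNormInt (u - v) := by
  have hnn : (0 : ℝ) ≤ (sqNormInt (u - v) : ℝ) := by
    have : 0 ≤ sqNormInt (u - v) := by unfold sqNormInt; positivity
    exact_mod_cast this
  rw [dist_intVec, Real.le_sqrt hc hnn, hc2, Int.cast_le]

/-- Distances in the periodic set in terms of `sqd` (first point's offset subtracted). -/
theorem dist_pp_le_iff (L : Fin 3 → ℤ) {M : ℕ} (P : Fin M → Fin 3 → ℤ) {c : ℝ} {c2 : ℤ} (hc : 0 ≤ c)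
    (hc2 : c ^ 2 = c2) (i j : Fin M) (n n' : Fin 3 → ℤ) :
    dist (pp L P (i, n)) (pp L P (j, n')) ≤ c ↔ sqd L P i j (n' - n) ≤ c2 := by
  rw [pp_mk, pp_mk, dist_comm, dist_intVec_le_iff hc hc2, ppt_sub_ppt]; rfl

/-- Lower distance bounds in the periodic set in terms of `sqd`. -/
theorem le_dist_pp_iff (L : Fin 3 → ℤ) {M : ℕ} (P : Fin M → Fin 3 → ℤ) {c : ℝ} {c2 : ℤ} (hc : 0 ≤ c)
    (hc2 : c ^ 2 = c2) (i j : Fin M) (n n' : Fin 3 → ℤ) :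
    c ≤ dist (pp L P (i, n)) (pp L P (j, n')) ↔ c2 ≤ sqd L P i j (n' - n) := by
  rw [pp_mk, pp_mk, dist_comm, le_dist_intVec_iff hc hc2, ppt_sub_ppt]; rfl

/-- FAR IMAGES: if the offset `d` leaves the box `{-1,0,1}³` then the image is farther than the
corresponding box edge: `(L k)² < sqd`. -/
theorem sqd_gt_of_not_box (L : Fin 3 → ℤ) {M : ℕ} (P : Fin M → Fin 3 → ℤ)
    (hbox : ∀ i k, 0 ≤ P i k ∧ P i k < L k) (i j : Fin M) (d : Fin 3 → ℤ) (k : Fin 3)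
    (hk : d k ≤ -2 ∨ 2 ≤ d k) : L k ^ 2 < sqd L P i j d := by
  have hb1 := hbox i k; have hb2 := hbox j k
  have hcoord : L k + 1 ≤ |(ppt L P j d - ppt L P i 0) k| := by
    simp only [Pi.sub_apply, ppt, Pi.zero_apply, mul_zero, add_zero]
    rcases hk with hk | hk
    · rw [abs_of_nonpos (by nlinarith)]; nlinarith
    · rw [abs_of_nonneg (by nlinarith)]; nlinarith
  have h1 : (L k + 1) ^ 2 ≤ (ppt L P j d - ppt L P i 0) k ^ 2 := by
    calc (L k + 1) ^ 2 ≤ |(ppt L P j d - ppt L P i 0) k| ^ 2 := by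
          have h0 : 0 ≤ L k + 1 := by linarith [hb1.1, hb1.2]
          nlinarith [hcoord, h0, abs_nonneg ((ppt L P j d - ppt L P i 0) k)]
      _ = (ppt L P j d - ppt L P i 0) k ^ 2 := sq_abs _
  have h2 := sq_le_sqNormInt (ppt L P j d - ppt L P i 0) k
  unfold sqd
  nlinarith

/-- Inside the box, a periodic image determines its offset and its motif point. -/
theorem eq_of_ppt_eq (L : Fin 3 → ℤ) {M : ℕ} (P : Fin M → Fin 3 → ℤ)
    (hbox : ∀ i k, 0 ≤ P i k ∧ P i k < L k) {j j' : Fin M} {m m' : Fin 3 → ℤ}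
    (h : ppt L P j m = ppt L P j' m') : m = m' ∧ P j = P j' := by
  have hk : ∀ k, m k = m' k ∧ P j k = P j' k := by
    intro k
    have hh := congrFun h k
    simp only [ppt] at hh
    obtain ⟨h1, h2⟩ := hbox j k
    obtain ⟨h3, h4⟩ := hbox j' k
    by_cases hm : m k = m' k
    · refine ⟨hm, ?_⟩
      rw [hm] at hh
      linarith
    · exfalso
      rcases lt_or_gt_of_ne hm with hlt | hlt
      · have h5 : m k + 1 ≤ m' k := hlt
        nlinarith
      · have h5 : m' k + 1 ≤ m k := hlt
        nlinarith
  exact ⟨funext fun k => (hk k).1, funext fun k => (hk k).2⟩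

/-! ## Certificates -/

/-- The finitely many integer facts of a periodic certificate (all decidable): the motif lies in
the box, every box edge is at least the gap radius, the thresholds are ordered, the motif points are
distinct, every motif point has exactly twelve images (over `Fin M × {-1,0,1}³`, itself excluded)
within `hi2`, and every other such image is at least `lo2` away and either within `hi2` or beyond
`gam2` (search data container, not a literature fact). -/
structure Cert (M : ℕ) (L : Fin 3 → ℤ) (P : Fin M → Fin 3 → ℤ) (lo2 hi2 gam2 : ℤ) : Prop where
  box : ∀ i k, 0 ≤ P i k ∧ P i k < L k
  edge : ∀ k, gam2 ≤ L k ^ 2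
  hi_lt_gam : hi2 < gam2
  lo_le_gam : lo2 ≤ gam2
  inj : ∀ i j : Fin M, P i = P j → i = j
  count : ∀ i : Fin M, (Finset.univ.filter fun q : Fin M × Fin 27 =>
      ¬ (q.1 = i ∧ q.2 = 13) ∧ sqd L P i q.1 (off27 q.2) ≤ hi2).card = 12
  sep : ∀ i : Fin M, ∀ q : Fin M × Fin 27, ¬ (q.1 = i ∧ q.2 = 13) →
      lo2 ≤ sqd L P i q.1 (off27 q.2) ∧
        (sqd L P i q.1 (off27 q.2) ≤ hi2 ∨ gam2 ≤ sqd L P i q.1 (off27 q.2))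

/-- The finite set indexing the common neighbours of the bond from motif point `i0` (offset `0`)
to the image of `i1` at offset `off27 d1`. -/
def commonIdx {M : ℕ} (L : Fin 3 → ℤ) (P : Fin M → Fin 3 → ℤ) (hi2 : ℤ) (i0 i1 : Fin M)
    (d1 : Fin 27) : Finset (Fin M × Fin 27) :=
  Finset.univ.filter fun q : Fin M × Fin 27 =>
    ¬ (q.1 = i0 ∧ q.2 = 13) ∧ ¬ (q.1 = i1 ∧ q.2 = d1) ∧ sqd L P i0 q.1 (off27 q.2) ≤ hi2 ∧
      sqNormInt (ppt L P q.1 (off27 q.2) - ppt L P i1 (off27 d1)) ≤ hi2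

/-- **Model facts of a periodic integer certificate.**  At the scale `a = D` with
`(D(1-τ))² = lo2`, `(D(1+τ))² = hi2`, `(Dγ)² = gam2`: the periodic set is infinite, EVERY site is
gapped-twelve at `(D, τ, γ)`, and for the bond from motif point `i0` to the image of `i1` at offset
`off27 d1` — two distinct sites, bonded iff `sqd ≤ hi2` — the common bonded neighbours are counted
EXACTLY by `commonIdx`. [folklore] -/
theorem cert_model {M : ℕ} {L : Fin 3 → ℤ} {P : Fin M → Fin 3 → ℤ} {lo2 hi2 gam2 : ℤ}
    (c : Cert M L P lo2 hi2 gam2) (τ γ : ℝ) (D : ℕ) (hD : 0 < D)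
    (hτlo : 0 ≤ 1 - τ) (hτhi : 0 ≤ 1 + τ) (hγ : 0 ≤ γ)
    (hlo : ((D : ℝ) * (1 - τ)) ^ 2 = lo2) (hhi : ((D : ℝ) * (1 + τ)) ^ 2 = hi2)
    (hgam : ((D : ℝ) * γ) ^ 2 = gam2) :
    (0 < M → (perSet L P).Infinite) ∧
    (∀ y ∈ perSet L P, GappedTwelveAt τ γ (perSet L P) D y) ∧
    ∀ (i0 i1 : Fin M) (d1 : Fin 27), ¬ (i1 = i0 ∧ d1 = 13) →
      pp L P (i0, 0) ∈ perSet L P ∧ pp L P (i1, off27 d1) ∈ perSet L P ∧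
      pp L P (i1, off27 d1) ≠ pp L P (i0, 0) ∧
      (dist (pp L P (i0, 0)) (pp L P (i1, off27 d1)) ≤ D * (1 + τ) ↔ sqd L P i0 i1 (off27 d1) ≤ hi2) ∧
      (commons τ (perSet L P) D (pp L P (i0, 0)) (pp L P (i1, off27 d1))).ncard =
        (commonIdx L P hi2 i0 i1 d1).card := by
  have hDpos : (0 : ℝ) < D := by exact_mod_cast hD
  have hlo0 : 0 ≤ (D : ℝ) * (1 - τ) := mul_nonneg hDpos.le hτlo
  have hhi0 : 0 ≤ (D : ℝ) * (1 + τ) := mul_nonneg hDpos.le hτhi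
  have hgam0 : 0 ≤ (D : ℝ) * γ := mul_nonneg hDpos.le hγ
  -- distance dictionary
  have hle : ∀ i j n n', dist (pp L P (i, n)) (pp L P (j, n')) ≤ (D : ℝ) * (1 + τ) ↔
      sqd L P i j (n' - n) ≤ hi2 := fun i j n n' => dist_pp_le_iff L P hhi0 hhi i j n n'
  have hge_lo : ∀ i j n n', (D : ℝ) * (1 - τ) ≤ dist (pp L P (i, n)) (pp L P (j, n')) ↔
      lo2 ≤ sqd L P i j (n' - n) := fun i j n n' => le_dist_pp_iff L P hlo0 hlo i j n n'
  have hge_gam : ∀ i j n n', (D : ℝ) * γ ≤ dist (pp L P (i, n)) (pp L P (j, n')) ↔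
      gam2 ≤ sqd L P i j (n' - n) := fun i j n n' => le_dist_pp_iff L P hgam0 hgam i j n n'
  -- injectivity of the indexing
  have hinj : ∀ q q', pp L P q = pp L P q' → q = q' := by
    rintro ⟨j, m⟩ ⟨j', m'⟩ hq
    rw [pp_mk, pp_mk] at hq
    have hq' := eq_of_ppt_eq L P c.box (intVec_injective hq)
    exact Prod.ext (c.inj _ _ hq'.2) hq'.1
  have hinjf : ∀ n : Fin 3 → ℤ,
      Function.Injective (fun q : Fin M × Fin 27 => pp L P (q.1, n + off27 q.2)) := by
    intro n q q' hqq
    have h' := hinj _ _ hqq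
    simp only [Prod.mk.injEq, add_right_inj] at h'
    exact Prod.ext h'.1 (off27_injective h'.2)
  -- a near image lies in the box
  have hboxed : ∀ i j d, sqd L P i j d ≤ hi2 → ∃ e : Fin 27, off27 e = d := by
    intro i j d hd
    apply exists_off27_of_box
    intro k
    by_contra hk
    have hk' : d k ≤ -2 ∨ 2 ≤ d k := by omega
    have h1 := sqd_gt_of_not_box L P c.box i j d k hk'
    have h2 := c.edge k
    have h3 := c.hi_lt_gam
    omega
  refine ⟨?_, ?_, ?_⟩
  · -- (0) infinite
    intro hM
    haveI : Nonempty (Fin M) := ⟨⟨0, hM⟩⟩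
    haveI : Infinite (Fin M × (Fin 3 → ℤ)) := inferInstance
    exact Set.infinite_range_of_injective fun q q' h => hinj q q' h
  · -- (1) every site is gapped-twelve
    rintro y ⟨⟨i, n⟩, rfl⟩
    refine ⟨?_, ?_⟩
    · -- the twelve
      have hset : {w ∈ perSet L P | w ≠ pp L P (i, n) ∧ dist (pp L P (i, n)) w ≤ (D : ℝ) * (1 + τ)} =
          ((Finset.univ.filter fun q : Fin M × Fin 27 =>
              ¬ (q.1 = i ∧ q.2 = 13) ∧ sqd L P i q.1 (off27 q.2) ≤ hi2).image
              fun q => pp L P (q.1, n + off27 q.2) :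
            Set (EuclideanSpace ℝ (Fin 3))) := by
        ext w
        simp only [perSet, Set.mem_setOf_eq, Set.mem_range, Finset.coe_image, Set.mem_image,
          Finset.mem_coe, Finset.mem_filter, Finset.mem_univ, true_and]
        constructor
        · rintro ⟨⟨⟨j, n'⟩, rfl⟩, hne', hd⟩
          have hd2 : sqd L P i j (n' - n) ≤ hi2 := (hle i j n n').1 hd
          obtain ⟨e, he⟩ := hboxed i j _ hd2
          refine ⟨(j, e), ⟨?_, by rw [he]; exact hd2⟩, ?_⟩
          · rintro ⟨rfl, rfl⟩
            apply hne'
            rw [off27_thirteen] at he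
            have : n' = n := by
              have := congrArg (· + n) he; simpa using this.symm
            rw [this]
          · show pp L P (j, n + off27 e) = pp L P (j, n')
            rw [he]; congr 1; simp
        · rintro ⟨⟨j, e⟩, ⟨hq1, hq2⟩, rfl⟩
          refine ⟨⟨(j, n + off27 e), rfl⟩, ?_, ?_⟩
          · intro heq
            have h' := hinj _ _ heq
            simp only [Prod.mk.injEq] at h'
            apply hq1
            refine ⟨h'.1, ?_⟩
            have : off27 e = 0 := by
              have := h'.2; simpa using this
            exact (off27_eq_zero_iff e).1 this
          · rw [hle]; simpa using hq2
      rw [hset, Set.ncard_coe_finset, Finset.card_image_of_injective _ (hinjf n), c.count i]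
    · -- separation
      rintro w ⟨⟨j, n'⟩, rfl⟩ hne'
      by_cases hb : ∃ e : Fin 27, off27 e = n' - n
      · obtain ⟨e, he⟩ := hb
        have hq : ¬ ((j, e).1 = i ∧ (j, e).2 = 13) := by
          rintro ⟨rfl, rfl⟩
          apply hne'
          rw [off27_thirteen] at he
          have : n' = n := by
            have := congrArg (· + n) he; simpa using this.symm
          rw [this]
        obtain ⟨hs1, hs2⟩ := c.sep i (j, e) hq
        simp only at hs1 hs2
        rw [he] at hs1 hs2
        refine ⟨(hge_lo i j n n').2 hs1, ?_⟩
        rcases hs2 with hs2 | hs2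
        · exact Or.inl ((hle i j n n').2 hs2)
        · exact Or.inr ((hge_gam i j n n').2 hs2)
      · -- far image
        have hfar : ∃ k, (n' - n) k ≤ -2 ∨ 2 ≤ (n' - n) k := by
          by_contra hcon
          push Not at hcon
          exact hb (exists_off27_of_box _ fun k => by have := hcon k; omega)
        obtain ⟨k, hk⟩ := hfar
        have h1 := sqd_gt_of_not_box L P c.box i j (n' - n) k hk
        have h2 := c.edge k
        have h3 := c.lo_le_gam
        refine ⟨(hge_lo i j n n').2 (by omega), Or.inr ((hge_gam i j n n').2 (by omega))⟩
  · -- (2) a bond of the motif and its common neighbours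
    intro i0 i1 d1 hne
    refine ⟨⟨_, rfl⟩, ⟨_, rfl⟩, ?_, ?_, ?_⟩
    · intro heq
      have h' := hinj _ _ heq
      simp only [Prod.mk.injEq] at h'
      exact hne ⟨h'.1, (off27_eq_zero_iff d1).1 h'.2⟩
    · rw [hle]; simp
    · have hEq : commons τ (perSet L P) (D : ℝ) (pp L P (i0, 0)) (pp L P (i1, off27 d1)) =
          ((commonIdx L P hi2 i0 i1 d1).image fun q => pp L P (q.1, 0 + off27 q.2) :
            Set (EuclideanSpace ℝ (Fin 3))) := by
        ext w
        simp only [commons, commonIdx, perSet, Set.mem_setOf_eq, Set.mem_range, Finset.coe_image,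
          Set.mem_image, Finset.mem_coe, Finset.mem_filter, Finset.mem_univ, true_and, zero_add]
        constructor
        · rintro ⟨⟨⟨j, n'⟩, rfl⟩, hne0, hne1, hd0, hd1⟩
          have hd2 : sqd L P i0 j (n' - 0) ≤ hi2 := (hle i0 j 0 n').1 hd0
          rw [sub_zero] at hd2
          obtain ⟨e, he⟩ := hboxed i0 j _ hd2
          subst he
          refine ⟨(j, e), ⟨?_, ?_, hd2, ?_⟩, rfl⟩
          · rintro ⟨rfl, rfl⟩
            exact hne0 (by rw [off27_thirteen])
          · rintro ⟨rfl, rfl⟩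
            exact hne1 rfl
          · have := (hle i1 j (off27 d1) (off27 e)).1 hd1
            unfold sqd at this
            rw [← ppt_sub_ppt] at this
            exact this
        · rintro ⟨⟨j, e⟩, ⟨hq1, hq2, hq3, hq4⟩, rfl⟩
          refine ⟨⟨(j, off27 e), rfl⟩, ?_, ?_, ?_, ?_⟩
          · intro heq
            have h' := hinj _ _ heq
            simp only [Prod.mk.injEq] at h'
            exact hq1 ⟨h'.1, (off27_eq_zero_iff e).1 h'.2⟩
          · intro heq
            have h' := hinj _ _ heq
            simp only [Prod.mk.injEq] at h'
            exact hq2 ⟨h'.1, off27_injective h'.2⟩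
          · rw [hle]; simpa using hq3
          · apply (hle i1 j (off27 d1) (off27 e)).2
            unfold sqd
            rw [← ppt_sub_ppt]
            exact hq4
      rw [hEq, Set.ncard_coe_finset, Finset.card_image_of_injective _ (hinjf 0)]

/-- **Replayer.**  A periodic integer certificate plus a bond `(i0, 0) — (i1, off27 d1)` with at
most three common neighbours refutes `TornFreeTol τ γ` (at the scale `a = D` for which
`(D(1-τ))² = lo2`, `(D(1+τ))² = hi2`, `(Dγ)² = gam2`). [folklore] -/
theorem not_tornFreeTol_of_cert {M : ℕ} {L : Fin 3 → ℤ} {P : Fin M → Fin 3 → ℤ}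
    {lo2 hi2 gam2 : ℤ} (c : Cert M L P lo2 hi2 gam2) (τ γ : ℝ) (D : ℕ) (hD : 0 < D)
    (hτlo : 0 ≤ 1 - τ) (hτhi : 0 ≤ 1 + τ) (hγ : 0 ≤ γ)
    (hlo : ((D : ℝ) * (1 - τ)) ^ 2 = lo2) (hhi : ((D : ℝ) * (1 + τ)) ^ 2 = hi2)
    (hgam : ((D : ℝ) * γ) ^ 2 = gam2)
    (i0 i1 : Fin M) (d1 : Fin 27) (hne : ¬ (i1 = i0 ∧ d1 = 13))
    (hbond : sqd L P i0 i1 (off27 d1) ≤ hi2)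
    (hcom : (commonIdx L P hi2 i0 i1 d1).card ≤ 3) :
    ¬ TornFreeTol τ γ := by
  intro h
  obtain ⟨-, hall, hb⟩ := cert_model c τ γ D hD hτlo hτhi hγ hlo hhi hgam
  obtain ⟨hy, hv, hvy, hdist, hcount⟩ := hb i0 i1 d1 hne
  have h4 := h (perSet L P) D (by exact_mod_cast hD) hall _ hy _ hv hvy (hdist.2 hbond)
  omega

end Summit.AtomisticToContinuum.Crystallization.Theorems.TornFree.Negative

end
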